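/-
Copyright (c) 2026. All rights reserved.
Released under Apache 2.0 license as described in the file LICENSE.
Authors: HodgeCM publication cell (pub-hodgecm), GR lane, seat GR-2 (`pub-hodgecm-own-hyp34`).
-/
import Literature.NumberTheory.Weil1964.ArchDualPairThetaMajorants
import Literature.NumberTheory.Weil1964.AdelicMetaplecticL2ContinuitySection
import HarnessLib

-- buildfix G11b-3 recipe (LEDGER B13-1/B13-3): elaborate sequentially (dependent telescopes of the dual-pair datum).
set_option Elab.async false

/-!
# `L²`-continuity of the Weil representation along a compatible splitting of the unitary dual pair `U(V) × U(W)`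

Topic `NumberTheory/Weil1964`; namespace `Literature.NumberTheory.Weil1964`.  KERNEL ONLY: theorems, no definition, no
named fact, nothing of [Weil1964] or [GelbartRogawski1991] asserted.

`ArchDualPairThetaMajorants` delivers Weil's theta majorants [Weil1964, Chap. III n° 41 Lemme 5, Théorème 6 (1)] for
`(u₁, u₂) ↦ ω_ψ(s_pair(u₁, u₂))` along a continuous COMPATIBLE splitting `s` of the adelic unitary dual pair with diagonal
hermitian forms ([GelbartRogawski1991, §3.1 (3.1.1)–(3.1.2)]), from ONE archimedean input (per-place Levi-form `KAK`
implementer data for Konno–Konno's real pairs) through the dictionary `archPhaseMap_toSp_pair` and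
`hasThetaMajorants_omega_comp_of_kakData`.  This file is the `L²` twin: the SAME inputs, fed to
`AdelicMetaplecticL2ContinuitySection.continuous_toL2_omega_comp_of_kakData`, give the STRONG `L²(𝐀_Fⁿ, ν)`-CONTINUITY
of every orbit map `(u₁, u₂) ↦ [ω_ψ(s_pair(u₁, u₂)) Φ]` (`Φ ∈ 𝒮(𝐀_Fⁿ)`, `ν` any Haar measure, `[·]` any class map
`i : 𝒮 → L²` with `i Φ =ᵐ Φ`) — the operator half of the "continuous section" clause of
[GelbartRogawski1991, Prop. 3.1.1 p. 455 L1–2] for the `L²` model of `ρ_ψ` along the splitting of record: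

* §1 `continuous_toL2_omega_pairSplitting` (+ `_of_nonempty`, `_canonical`) — general `E/F` totally real base,
  `J_V = diag(t_V)`, `J_W = diag(t_W)`;
* §2 `continuous_toL2_omega_cmPairSplitting` (+ `_of_nonempty`, `_canonical`, **`_of_signs`**) — the CM data of
  `UnitaryDualPairThetaKernelCM` and its chosen compatible splitting `cmPairSplitting`;
* §3 `continuous_toL2_omega_cmPairSplitting_of_signs_two` (hermitian plane `W`) and
  **`continuous_toL2_omega_cmPairSplitting_of_signs_one`** (hermitian LINE `W`, `M = 1`: no hypothesis on `W` at all —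
  the case of [GelbartRogawski1991, Prop. 3.1.1] itself, `U(V) × U(1)`).

The generality is that of the tree's Levi-form `KAK` kinds (first factor of real rank `≤ 1` at the distinguished place and
definite elsewhere); `U(𝐀)` is first countable (a subgroup of `GL_N(𝐀_E)`), so dominated convergence applies.

## References
* [Weil1964] A. Weil, Acta Math. 111 (1964) 143–211, Chap. III n° 39 p. 189, n° 41 Lemme 5 p. 192, Théorème 6 (1)
  p. 193.
* [GelbartRogawski1991] S. Gelbart, J. Rogawski, Invent. Math. 105 (1991) 445–472, §3.1 p. 454, Prop. 3.1.1 p. 455 L1–2.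
* [KonnoKonno2007] K. Konno, T. Konno, §3.1 (3.1).
* [Folland1989] G. B. Folland, *Harmonic Analysis in Phase Space* (1989), §4.2 (4.24) p. 156, Prop. (4.39).
-/

set_option autoImplicit false

noncomputable section

open scoped Matrix Real Classical ComplexConjugate Kronecker
open Complex NumberField NumberField.InfinitePlace NumberField.mixedEmbedding IsDedekindDomain MeasureTheory
open Literature.NumberTheory.Automorphic Literature.NumberTheory.Automorphic.UnitaryGroup
open Literature.RepresentationTheory.HeisenbergGroup Literature.Analysis.SegalBargmann
open Literature.RepresentationTheory.KonnoKonno2007 Literature.RepresentationTheory.KonnoKonno2007.RealDualPair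

namespace Literature.NumberTheory.Weil1964

/-! ## §0 `U(J)(𝐀_F)` is first countable -/

section FirstCountable

variable (F : Type) [Field F] (E : Type) [Field E] [NumberField E] [Algebra F E] (c : E ≃ₐ[F] E)
  (N : ℕ) (J : Matrix (Fin N) (Fin N) E)

/-- `U(J)(𝐀_F) ⊆ GL_N(𝐀_E)` is first countable (`𝐀_E` is second countable; units carry the topology induced by
`M × Mᵐᵒᵖ`). [cite: GelbartRogawski1991, §3.1 p. 454 L37–40] -/
theorem firstCountableTopology_unitaryGroup_adelic : FirstCountableTopology (UnitaryGroup.adelic F E c N J) := by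
  haveI h0 : SecondCountableTopology (AdeleRing (𝓞 E) E) := secondCountableTopology_adeleRing E
  haveI h1 : FirstCountableTopology (Matrix (Fin N) (Fin N) (AdeleRing (𝓞 E) E)) :=
    inferInstanceAs (FirstCountableTopology (Fin N → Fin N → AdeleRing (𝓞 E) E))
  haveI h2 : FirstCountableTopology (Matrix (Fin N) (Fin N) (AdeleRing (𝓞 E) E))ᵐᵒᵖ :=
    (MulOpposite.opHomeomorph (M := Matrix (Fin N) (Fin N) (AdeleRing (𝓞 E) E))).symm.isInducing.firstCountableTopology
  haveI h3 : FirstCountableTopology (GL (Fin N) (AdeleRing (𝓞 E) E)) :=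
    Units.isInducing_embedProduct.firstCountableTopology
  exact Topology.IsInducing.subtypeVal.firstCountableTopology

end FirstCountable

/-! ## §1 The unitary dual pair with diagonal forms -/

section Pair

variable {F : Type} [Field F] [NumberField F] (E : Type) [Field E] [NumberField E] [Algebra F E] (c : E ≃ₐ[F] E)
  (N M : ℕ) {m : ℕ} (e : Fin N × Fin M ≃ Fin m) (hc : c ≠ 1)
  (wOf : {v : InfinitePlace F // v.IsReal} → {w : InfinitePlace E // w.IsComplex})
  (hw : ∀ v, c • (wOf v).1 = (wOf v).1) (hover : ∀ v, (wOf v).1.comap (algebraMap F E) = v.1)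
  (tV : Fin N → F) (tW : Fin M → F) {JV : Matrix (Fin N) (Fin N) E} {JW : Matrix (Fin M) (Fin M) E}
  (hJV : JV = (Matrix.diagonal tV).map (algebraMap F E)) (hJW : JW = (Matrix.diagonal tW).map (algebraMap F E))
  {P Q R S : {v : InfinitePlace F // v.IsReal} → Type*} [∀ v, Fintype (P v)] [∀ v, DecidableEq (P v)]
  [∀ v, Fintype (Q v)] [∀ v, DecidableEq (Q v)] [∀ v, Fintype (R v)] [∀ v, DecidableEq (R v)]
  [∀ v, Fintype (S v)] [∀ v, DecidableEq (S v)]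
  [IsTotallyReal F] [Algebra.IsQuadraticExtension F E] {δ : E} (hcδ : c δ = -δ) (hδ : δ ≠ 0) {d : F}
  (hd : δ * δ = algebraMap F E d) (hV : (Matrix.diagonal tV).IsSymm) (hW : (Matrix.diagonal tW).IsSymm)
variable [MeasurableSpace (AdeleRing (𝓞 F) F)] [BorelSpace (AdeleRing (𝓞 F) F)]
  (ν : Measure (Fin m → AdeleRing (𝓞 F) F)) [ν.IsAddHaarMeasure]
  (i : piSchwartzBruhat F (Fin m) →ₗ[ℂ] Lp ℂ 2 ν)
  (hi : ∀ Φ : piSchwartzBruhat F (Fin m),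
    ((i Φ : Lp ℂ 2 ν) : (Fin m → AdeleRing (𝓞 F) F) → ℂ) =ᵐ[ν] (Φ : (Fin m → AdeleRing (𝓞 F) F) → ℂ))

include hi in
/-- **`L²`-continuity of the Weil representation along a compatible splitting of the unitary dual pair.**  For
`J_V = diag(t_V) ⊗ 1`, `J_W = diag(t_W) ⊗ 1` (`t_V`, `t_W` nonsingular), per-place sign frames `ε_V, ε_W` and adapted
scalings, a family of Levi-form `KAK` inputs `I v` for Konno–Konno's real pairs, and a continuous COMPATIBLE splitting
`s : U(J_V ⊗ J_W)(𝔸) → Mp_ψ(𝕎_𝔸)ᶜᵒⁿᵗ`: for every Haar measure `ν` on `𝐀_Fᵐ`, every class map `i : 𝒮 → L²(ν)` and every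
`Φ ∈ 𝒮(𝐀_Fᵐ)`, the orbit map `(u₁, u₂) ↦ [ω_ψ(s_pair(u₁, u₂)) Φ]` is CONTINUOUS in `L²` — Weil's Lemme 5 through
`continuous_toL2_omega_comp_of_kakData`, with the ingredients of `hasThetaMajorants_omega_pairSplitting`.
[cite: Weil1964, Chap. III n° 41 Lemme 5 p. 192, n° 39 p. 189; GelbartRogawski1991, §3.1 Prop. 3.1.1 p. 455 L1–2;
Folland1989, §4.2 (4.24) p. 156, Prop. (4.39)] -/
theorem continuous_toL2_omega_pairSplitting (hc : c ≠ 1)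
    (wOf : {v : InfinitePlace F // v.IsReal} → {w : InfinitePlace E // w.IsComplex})
    (hw : ∀ v, c • (wOf v).1 = (wOf v).1) (hover : ∀ v, (wOf v).1.comap (algebraMap F E) = v.1)
    (εV : ∀ v, Fin N ≃ P v ⊕ Q v) (εW : ∀ v, Fin M ≃ R v ⊕ S v)
    {DV : {v : InfinitePlace F // v.IsReal} → Fin N → ℝ} {DW : {v : InfinitePlace F // v.IsReal} → Fin M → ℝ}
    (hDV0 : ∀ v i, DV v i ≠ 0) (hDW0 : ∀ v j, DW v j ≠ 0) {cV cW : {v : InfinitePlace F // v.IsReal} → ℝ}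
    (hcV : ∀ v, cV v ≠ 0) (hcW : ∀ v, cW v ≠ 0)
    (htV : ∀ v i, embedding_of_isReal v.2 (tV i) = cV v * signOf (εV v i) * DV v i ^ 2)
    (htW : ∀ v j, embedding_of_isReal v.2 (tW j) = cW v * signOf (εW v j) * DW v j ^ 2)
    (hcc : ∀ v, cV v * cW v = ((wOf v).1.embedding δ).im)
    (hVd : IsUnit (Matrix.diagonal tV).det) (hWd : IsUnit (Matrix.diagonal tW).det)
    {Kk Pa : {v : InfinitePlace F // v.IsReal} → Type*} [∀ v, TopologicalSpace (Kk v)]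
    [∀ v, TopologicalSpace (Pa v)] {κf : ∀ v, Kk v → Ginf (P v) (Q v) (R v) (S v)}
    {af : ∀ v, Pa v → Ginf (P v) (Q v) (R v) (S v)}
    (I : ∀ v, LeviKAKInput
      (fun g : Ginf (P v) (Q v) (R v) (S v) =>
        (⇑((ι𝕎 (P v) (Q v) (R v) (S v) g).1 :
          ((DPIdx (P v) (Q v) (R v) (S v) → ℝ) × (DPIdx (P v) (Q v) (R v) (S v) → ℝ)) ≃ₗ[ℝ] ((DPIdx (P v) (Q v) (R v) (S v) → ℝ) × (DPIdx (P v) (Q v) (R v) (S v) → ℝ))) :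
          PhaseMap (DPIdx (P v) (Q v) (R v) (S v))))
      (κf v) (af v))
    {s : UnitaryGroup.adelicPair F E c N M JV JW →* adelicMpCont F (Fin m)
      (GelbartRogawski1991.UnitaryDualPair.adelicGram F e (Matrix.diagonal tV) (Matrix.diagonal tW))}
    (hs : (GelbartRogawski1991.UnitaryDualPair.splittingDatum F E c N M e JV JW hcδ hδ hd hV hW hVd hWd hJV
      hJW).IsCompatible s)
    (hsc : Continuous s) (Φ : piSchwartzBruhat F (Fin m)) :
    Continuous fun p : UnitaryGroup.adelic F E c N JV × UnitaryGroup.adelic F E c M JW =>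
      i (adelicMpCont.omega F (Fin m)
        (GelbartRogawski1991.UnitaryDualPair.adelicGram F e (Matrix.diagonal tV) (Matrix.diagonal tW))
        (GelbartRogawski1991.UnitaryDualPair.pairSplitting F E c N M e JV JW s p) Φ) := by
  haveI := firstCountableTopology_unitaryGroup_adelic F E c N JV
  haveI := firstCountableTopology_unitaryGroup_adelic F E c M JW
  exact continuous_toL2_omega_comp_of_kakData ν i hi
    (GelbartRogawski1991.UnitaryDualPair.isUnit_adelicGram F e hVd hWd)
    (GelbartRogawski1991.UnitaryDualPair.pairSplitting F E c N M e JV JW s)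
    (GelbartRogawski1991.UnitaryDualPair.continuous_pairSplitting F E c N M e JV JW hsc)
    (scaledFrame F (Fin m) (pairScale N M (e := e) DV DW) (pairScale_ne_zero N M hDV0 hDW0))
    (isUnit_archMat_of_isUnit _ (GelbartRogawski1991.UnitaryDualPair.isUnit_adelicGram F e hVd hWd))
    (kakImplementerData_leviFamily_places_reindex (fun v => pairFrame (P v) (Q v) (R v) (S v) e (εV v) (εW v)) I)
    (fun p v => archPairPlace E c N M hc wOf hw hover tV tW hJV hJW εV εW hDV0 hDW0 hcV hcW htV htW v p)
    (continuous_archPairPlace_pi E c N M hc wOf hw hover tV tW hJV hJW εV εW hDV0 hDW0 hcV hcW htV htW)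
    (fun p => by
      rw [GelbartRogawski1991.UnitaryDualPair.proj_pairSplitting F E c N M e JV JW hcδ hδ hd hV hW hVd hWd hJV
        hJW hs p]
      exact archPhaseMap_toSp_pair E c N M e hc wOf hw hover tV tW hJV hJW εV εW hDV0 hDW0 hcV hcW htV htW hcδ
        hδ hd hV hW hcc _ p.1 p.2) Φ

include hi in
/-- the same from ONE kind-erased Levi-form `KAK` input per place (`AnyLeviKAKInput`, chosen by `Classical.choice`).
[cite: Weil1964, Chap. III n° 41 Lemme 5 p. 192; GelbartRogawski1991, §3.1 Prop. 3.1.1 p. 455 L1–2; Folland1989, §4.2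
(4.24) p. 156] -/
theorem continuous_toL2_omega_pairSplitting_of_nonempty (hc : c ≠ 1)
    (wOf : {v : InfinitePlace F // v.IsReal} → {w : InfinitePlace E // w.IsComplex})
    (hw : ∀ v, c • (wOf v).1 = (wOf v).1) (hover : ∀ v, (wOf v).1.comap (algebraMap F E) = v.1)
    (εV : ∀ v, Fin N ≃ P v ⊕ Q v) (εW : ∀ v, Fin M ≃ R v ⊕ S v)
    {DV : {v : InfinitePlace F // v.IsReal} → Fin N → ℝ} {DW : {v : InfinitePlace F // v.IsReal} → Fin M → ℝ}
    (hDV0 : ∀ v i, DV v i ≠ 0) (hDW0 : ∀ v j, DW v j ≠ 0) {cV cW : {v : InfinitePlace F // v.IsReal} → ℝ}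
    (hcV : ∀ v, cV v ≠ 0) (hcW : ∀ v, cW v ≠ 0)
    (htV : ∀ v i, embedding_of_isReal v.2 (tV i) = cV v * signOf (εV v i) * DV v i ^ 2)
    (htW : ∀ v j, embedding_of_isReal v.2 (tW j) = cW v * signOf (εW v j) * DW v j ^ 2)
    (hcc : ∀ v, cV v * cW v = ((wOf v).1.embedding δ).im)
    (hVd : IsUnit (Matrix.diagonal tV).det) (hWd : IsUnit (Matrix.diagonal tW).det)
    (hI : ∀ v, Nonempty (AnyLeviKAKInput ((fun g : Ginf (P v) (Q v) (R v) (S v) => (⇑((ι𝕎 (P v) (Q v) (R v) (S v) g).1 : ((DPIdx (P v) (Q v) (R v) (S v) → ℝ) × (DPIdx (P v) (Q v) (R v) (S v) → ℝ)) ≃ₗ[ℝ] ((DPIdx (P v) (Q v) (R v) (S v) → ℝ) × (DPIdx (P v) (Q v) (R v) (S v) → ℝ))) : PhaseMap (DPIdx (P v) (Q v) (R v) (S v)))))))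
    {s : UnitaryGroup.adelicPair F E c N M JV JW →* adelicMpCont F (Fin m)
      (GelbartRogawski1991.UnitaryDualPair.adelicGram F e (Matrix.diagonal tV) (Matrix.diagonal tW))}
    (hs : (GelbartRogawski1991.UnitaryDualPair.splittingDatum F E c N M e JV JW hcδ hδ hd hV hW hVd hWd hJV
      hJW).IsCompatible s)
    (hsc : Continuous s) (Φ : piSchwartzBruhat F (Fin m)) :
    Continuous fun p : UnitaryGroup.adelic F E c N JV × UnitaryGroup.adelic F E c M JW =>
      i (adelicMpCont.omega F (Fin m)
        (GelbartRogawski1991.UnitaryDualPair.adelicGram F e (Matrix.diagonal tV) (Matrix.diagonal tW))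
        (GelbartRogawski1991.UnitaryDualPair.pairSplitting F E c N M e JV JW s p) Φ) :=
  continuous_toL2_omega_pairSplitting E c N M e tV tW hJV hJW hcδ hδ hd hV hW ν i hi hc wOf hw hover εV εW hDV0
    hDW0 hcV hcW htV htW hcc hVd hWd (fun v => (Classical.choice (hI v)).input) hs hsc Φ

include hi in
/-- the same with CANONICAL sign frames and scalings (`signSplit`, `sqrtAbs` of `placeSignVec`; the consumer supplies a
nowhere-zero sign convention `c_V` and ONE kind-erased `KAK` input per place for the resulting real pair).
[cite: Weil1964, Chap. III n° 41 Lemme 5 p. 192; GelbartRogawski1991, §3.1 Prop. 3.1.1 p. 455 L1–2;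
KonnoKonno2007, §3.1 (3.1); Folland1989, §4.2 (4.24) p. 156] -/
theorem continuous_toL2_omega_pairSplitting_canonical (hc : c ≠ 1)
    (wOf : {v : InfinitePlace F // v.IsReal} → {w : InfinitePlace E // w.IsComplex})
    (hw : ∀ v, c • (wOf v).1 = (wOf v).1) (hover : ∀ v, (wOf v).1.comap (algebraMap F E) = v.1)
    (cV : {v : InfinitePlace F // v.IsReal} → ℝ) (hcV : ∀ v, cV v ≠ 0)
    (hVd : IsUnit (Matrix.diagonal tV).det) (hWd : IsUnit (Matrix.diagonal tW).det)
    (hI : ∀ v, Nonempty (AnyLeviKAKInput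
      ((fun g : Ginf (PosIdx (placeSignVec tV cV v)) (NegIdx (placeSignVec tV cV v)) (PosIdx (placeSignVec tW (fun v => ((wOf v).1.embedding δ).im / cV v) v)) (NegIdx (placeSignVec tW (fun v => ((wOf v).1.embedding δ).im / cV v) v)) => (⇑((ι𝕎 (PosIdx (placeSignVec tV cV v)) (NegIdx (placeSignVec tV cV v)) (PosIdx (placeSignVec tW (fun v => ((wOf v).1.embedding δ).im / cV v) v)) (NegIdx (placeSignVec tW (fun v => ((wOf v).1.embedding δ).im / cV v) v)) g).1 : ((DPIdx (PosIdx (placeSignVec tV cV v)) (NegIdx (placeSignVec tV cV v)) (PosIdx (placeSignVec tW (fun v => ((wOf v).1.embedding δ).im / cV v) v)) (NegIdx (placeSignVec tW (fun v => ((wOf v).1.embedding δ).im / cV v) v)) → ℝ) × (DPIdx (PosIdx (placeSignVec tV cV v)) (NegIdx (placeSignVec tV cV v)) (PosIdx (placeSignVec tW (fun v => ((wOf v).1.embedding δ).im / cV v) v)) (NegIdx (placeSignVec tW (fun v => ((wOf v).1.embedding δ).im / cV v) v)) → ℝ)) ≃ₗ[ℝ] ((DPIdx (PosIdx (placeSignVec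 tV cV v)) (NegIdx (placeSignVec tV cV v)) (PosIdx (placeSignVec tW (fun v => ((wOf v).1.embedding δ).im / cV v) v)) (NegIdx (placeSignVec tW (fun v => ((wOf v).1.embedding δ).im / cV v) v)) → ℝ) × (DPIdx (PosIdx (placeSignVec tV cV v)) (NegIdx (placeSignVec tV cV v)) (PosIdx (placeSignVec tW (fun v => ((wOf v).1.embedding δ).im / cV v) v)) (NegIdx (placeSignVec tW (fun v => ((wOf v).1.embedding δ).im / cV v) v)) → ℝ))) : PhaseMap (DPIdx (PosIdx (placeSignVec tV cV v)) (NegIdx (placeSignVec tV cV v)) (PosIdx (placeSignVec tW (fun v => ((wOf v).1.embedding δ).im / cV v) v)) (NegIdx (placeSignVec tW (fun v => ((wOf v).1.embedding δ).im / cV v) v))))))))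
    {s : UnitaryGroup.adelicPair F E c N M JV JW →* adelicMpCont F (Fin m)
      (GelbartRogawski1991.UnitaryDualPair.adelicGram F e (Matrix.diagonal tV) (Matrix.diagonal tW))}
    (hs : (GelbartRogawski1991.UnitaryDualPair.splittingDatum F E c N M e JV JW hcδ hδ hd hV hW hVd hWd hJV
      hJW).IsCompatible s)
    (hsc : Continuous s) (Φ : piSchwartzBruhat F (Fin m)) :
    Continuous fun p : UnitaryGroup.adelic F E c N JV × UnitaryGroup.adelic F E c M JW =>
      i (adelicMpCont.omega F (Fin m)
        (GelbartRogawski1991.UnitaryDualPair.adelicGram F e (Matrix.diagonal tV) (Matrix.diagonal tW))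
        (GelbartRogawski1991.UnitaryDualPair.pairSplitting F E c N M e JV JW s p) Φ) :=
  have hδv : ∀ v : {v : InfinitePlace F // v.IsReal}, ((wOf v).1.embedding δ).im ≠ 0 := fun v =>
    UnitaryGroup.im_embedding_delta_ne_zero F E c (wOf v) (hw v) hc hcδ hδ
  have htV0 : ∀ (v : {v : InfinitePlace F // v.IsReal}) i, embedding_of_isReal v.2 (tV i) ≠ 0 := fun v i =>
    (map_ne_zero _).2 (ne_zero_of_isUnit_det_diagonal hVd i)
  have htW0 : ∀ (v : {v : InfinitePlace F // v.IsReal}) j, embedding_of_isReal v.2 (tW j) ≠ 0 := fun v j =>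
    (map_ne_zero _).2 (ne_zero_of_isUnit_det_diagonal hWd j)
  continuous_toL2_omega_pairSplitting_of_nonempty E c N M e tV tW hJV hJW hcδ hδ hd hV hW ν i hi hc wOf hw hover
    (fun v => signSplit (placeSignVec tV cV v))
    (fun v => signSplit (placeSignVec tW (fun v => ((wOf v).1.embedding δ).im / cV v) v))
    (DV := fun v => sqrtAbs (placeSignVec tV cV v))
    (DW := fun v => sqrtAbs (placeSignVec tW (fun v => ((wOf v).1.embedding δ).im / cV v) v))
    (fun v i => sqrtAbs_ne_zero (div_ne_zero (htV0 v i) (hcV v)))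
    (fun v j => sqrtAbs_ne_zero (div_ne_zero (htW0 v j) (div_ne_zero (hδv v) (hcV v))))
    (cV := cV) (cW := fun v => ((wOf v).1.embedding δ).im / cV v) hcV
    (fun v => div_ne_zero (hδv v) (hcV v))
    (fun v i => eq_mul_signOf_signSplit_mul_sqrtAbs_sq (hcV v) (fun j => embedding_of_isReal v.2 (tV j)) i
      (htV0 v i))
    (fun v j => eq_mul_signOf_signSplit_mul_sqrtAbs_sq (div_ne_zero (hδv v) (hcV v))
      (fun j => embedding_of_isReal v.2 (tW j)) j (htW0 v j))
    (fun v => by rw [← mul_div_assoc, mul_div_cancel_left₀ _ (hcV v)]) hVd hWd hI hs hsc Φ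

end Pair

/-! ## §2 The CM data of `UnitaryDualPairThetaKernelCM` -/

section CM

variable (L : Type) [Field L] [NumberField L] [IsCMField L]
variable {N M n : ℕ} (e : Fin N × Fin M ≃ Fin n)
  (dV : Fin N → L) (hdV : ∀ i, IsCMField.complexConj L (dV i) = dV i) (hdV0 : ∀ i, dV i ≠ 0)
  (dW : Fin M → L) (hdW : ∀ i, IsCMField.complexConj L (dW i) = dW i) (hdW0 : ∀ i, dW i ≠ 0)
  {P Q R S : {v : InfinitePlace ↥(maximalRealSubfield L) // v.IsReal} → Type*} [∀ v, Fintype (P v)]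
  [∀ v, DecidableEq (P v)] [∀ v, Fintype (Q v)] [∀ v, DecidableEq (Q v)] [∀ v, Fintype (R v)]
  [∀ v, DecidableEq (R v)] [∀ v, Fintype (S v)] [∀ v, DecidableEq (S v)]
variable [MeasurableSpace (AdeleRing (𝓞 ↥(maximalRealSubfield L)) ↥(maximalRealSubfield L))]
  [BorelSpace (AdeleRing (𝓞 ↥(maximalRealSubfield L)) ↥(maximalRealSubfield L))]
  (ν : Measure (Fin n → AdeleRing (𝓞 ↥(maximalRealSubfield L)) ↥(maximalRealSubfield L))) [ν.IsAddHaarMeasure]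
  (i : piSchwartzBruhat (↥(maximalRealSubfield L)) (Fin n) →ₗ[ℂ] Lp ℂ 2 ν)
  (hi : ∀ Φ : piSchwartzBruhat (↥(maximalRealSubfield L)) (Fin n),
    ((i Φ : Lp ℂ 2 ν) : (Fin n → AdeleRing (𝓞 ↥(maximalRealSubfield L)) ↥(maximalRealSubfield L)) → ℂ) =ᵐ[ν]
      (Φ : (Fin n → AdeleRing (𝓞 ↥(maximalRealSubfield L)) ↥(maximalRealSubfield L)) → ℂ))

include hi in
/-- **`L²`-continuity of the Weil representation along the CM pair splitting `cmPairSplitting`** (per-place sign frames,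
adapted scalings and Levi-form `KAK` inputs supplied). [cite: Weil1964, Chap. III n° 41 Lemme 5 p. 192, n° 39 p. 189;
GelbartRogawski1991, §3.1 Prop. 3.1.1 p. 455 L1–2; KonnoKonno2007, §3.1 (3.1); Folland1989, §4.2 (4.24) p. 156] -/
theorem continuous_toL2_omega_cmPairSplitting
    (εV : ∀ v, Fin N ≃ P v ⊕ Q v) (εW : ∀ v, Fin M ≃ R v ⊕ S v)
    {DV : {v : InfinitePlace ↥(maximalRealSubfield L) // v.IsReal} → Fin N → ℝ}
    {DW : {v : InfinitePlace ↥(maximalRealSubfield L) // v.IsReal} → Fin M → ℝ}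
    (hDV0 : ∀ v i, DV v i ≠ 0) (hDW0 : ∀ v j, DW v j ≠ 0)
    {cV cW : {v : InfinitePlace ↥(maximalRealSubfield L) // v.IsReal} → ℝ} (hcV : ∀ v, cV v ≠ 0)
    (hcW : ∀ v, cW v ≠ 0)
    (htV : ∀ v i, embedding_of_isReal v.2 (cmRealVec L dV hdV i) = cV v * signOf (εV v i) * DV v i ^ 2)
    (htW : ∀ v j, embedding_of_isReal v.2 (cmRealVec L dW hdW j) = cW v * signOf (εW v j) * DW v j ^ 2)
    (hcc : ∀ v, cV v * cW v =
      ((cmPlaceOver L v).1.embedding (GelbartRogawski1991.UnitaryDualPair.imagUnit L)).im)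
    (hGR : (GelbartRogawski1991.UnitaryDualPair.cmSplittingDatum L e dV hdV hdV0 dW hdW hdW0).CompatibleSplitting)
    {Kk Pa : {v : InfinitePlace ↥(maximalRealSubfield L) // v.IsReal} → Type*} [∀ v, TopologicalSpace (Kk v)]
    [∀ v, TopologicalSpace (Pa v)] {κf : ∀ v, Kk v → Ginf (P v) (Q v) (R v) (S v)}
    {af : ∀ v, Pa v → Ginf (P v) (Q v) (R v) (S v)}
    (I : ∀ v, LeviKAKInput
      (fun g : Ginf (P v) (Q v) (R v) (S v) =>
        (⇑((ι𝕎 (P v) (Q v) (R v) (S v) g).1 :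
          ((DPIdx (P v) (Q v) (R v) (S v) → ℝ) × (DPIdx (P v) (Q v) (R v) (S v) → ℝ)) ≃ₗ[ℝ] ((DPIdx (P v) (Q v) (R v) (S v) → ℝ) × (DPIdx (P v) (Q v) (R v) (S v) → ℝ))) :
          PhaseMap (DPIdx (P v) (Q v) (R v) (S v))))
      (κf v) (af v))
    (Φ : piSchwartzBruhat (↥(maximalRealSubfield L)) (Fin n)) :
    Continuous fun
      (p : ↥(UnitaryGroup.adelic (↥(maximalRealSubfield L)) L (IsCMField.complexConj L) N (Matrix.diagonal dV)) ×
        ↥(UnitaryGroup.adelic (↥(maximalRealSubfield L)) L (IsCMField.complexConj L) M (Matrix.diagonal dW))) =>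
      i (adelicMpCont.omega (↥(maximalRealSubfield L)) (Fin n)
          (GelbartRogawski1991.UnitaryDualPair.adelicGram (↥(maximalRealSubfield L)) e
            (GelbartRogawski1991.UnitaryDualPair.realDiagonal L dV hdV)
            (GelbartRogawski1991.UnitaryDualPair.realDiagonal L dW hdW))
          (GelbartRogawski1991.UnitaryDualPair.cmPairSplitting L e dV hdV hdV0 dW hdW hdW0 hGR p) Φ) :=
  continuous_toL2_omega_pairSplitting L (IsCMField.complexConj L) N M e (cmRealVec L dV hdV) (cmRealVec L dW hdW)
    (GelbartRogawski1991.UnitaryDualPair.realDiagonal_map L dV hdV).symm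
    (GelbartRogawski1991.UnitaryDualPair.realDiagonal_map L dW hdW).symm
    (GelbartRogawski1991.UnitaryDualPair.complexConj_imagUnit L)
    (GelbartRogawski1991.UnitaryDualPair.imagUnit_ne_zero L)
    (GelbartRogawski1991.UnitaryDualPair.imagUnit_mul_self L)
    (GelbartRogawski1991.UnitaryDualPair.realDiagonal_isSymm L dV hdV)
    (GelbartRogawski1991.UnitaryDualPair.realDiagonal_isSymm L dW hdW) ν i hi
    (IsCMField.complexConj_ne_one L) (cmPlaceOver L) (cmPlaceOver_smul L) (cmPlaceOver_comap L)
    εV εW hDV0 hDW0 hcV hcW htV htW hcc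
    (GelbartRogawski1991.UnitaryDualPair.isUnit_det_realDiagonal L dV hdV hdV0)
    (GelbartRogawski1991.UnitaryDualPair.isUnit_det_realDiagonal L dW hdW hdW0) I
    (GelbartRogawski1991.UnitaryDualPair.splittingOf_isCompatible _ _ _ _ _ _ _ _ _ _ _ _ _ _ _ _ _ hGR)
    (GelbartRogawski1991.UnitaryDualPair.continuous_splittingOf _ _ _ _ _ _ _ _ _ _ _ _ _ _ _ _ _ hGR) Φ

include hi in
/-- the same from ONE kind-erased Levi-form `KAK` input per place. [cite: Weil1964, Chap. III n° 41 Lemme 5 p. 192;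
GelbartRogawski1991, §3.1 Prop. 3.1.1 p. 455 L1–2; Folland1989, §4.2 (4.24) p. 156] -/
theorem continuous_toL2_omega_cmPairSplitting_of_nonempty
    (εV : ∀ v, Fin N ≃ P v ⊕ Q v) (εW : ∀ v, Fin M ≃ R v ⊕ S v)
    {DV : {v : InfinitePlace ↥(maximalRealSubfield L) // v.IsReal} → Fin N → ℝ}
    {DW : {v : InfinitePlace ↥(maximalRealSubfield L) // v.IsReal} → Fin M → ℝ}
    (hDV0 : ∀ v i, DV v i ≠ 0) (hDW0 : ∀ v j, DW v j ≠ 0)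
    {cV cW : {v : InfinitePlace ↥(maximalRealSubfield L) // v.IsReal} → ℝ} (hcV : ∀ v, cV v ≠ 0)
    (hcW : ∀ v, cW v ≠ 0)
    (htV : ∀ v i, embedding_of_isReal v.2 (cmRealVec L dV hdV i) = cV v * signOf (εV v i) * DV v i ^ 2)
    (htW : ∀ v j, embedding_of_isReal v.2 (cmRealVec L dW hdW j) = cW v * signOf (εW v j) * DW v j ^ 2)
    (hcc : ∀ v, cV v * cW v =
      ((cmPlaceOver L v).1.embedding (GelbartRogawski1991.UnitaryDualPair.imagUnit L)).im)
    (hGR : (GelbartRogawski1991.UnitaryDualPair.cmSplittingDatum L e dV hdV hdV0 dW hdW hdW0).CompatibleSplitting)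
    (hI : ∀ v, Nonempty (AnyLeviKAKInput ((fun g : Ginf (P v) (Q v) (R v) (S v) => (⇑((ι𝕎 (P v) (Q v) (R v) (S v) g).1 : ((DPIdx (P v) (Q v) (R v) (S v) → ℝ) × (DPIdx (P v) (Q v) (R v) (S v) → ℝ)) ≃ₗ[ℝ] ((DPIdx (P v) (Q v) (R v) (S v) → ℝ) × (DPIdx (P v) (Q v) (R v) (S v) → ℝ))) : PhaseMap (DPIdx (P v) (Q v) (R v) (S v)))))))
    (Φ : piSchwartzBruhat (↥(maximalRealSubfield L)) (Fin n)) :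
    Continuous fun
      (p : ↥(UnitaryGroup.adelic (↥(maximalRealSubfield L)) L (IsCMField.complexConj L) N (Matrix.diagonal dV)) ×
        ↥(UnitaryGroup.adelic (↥(maximalRealSubfield L)) L (IsCMField.complexConj L) M (Matrix.diagonal dW))) =>
      i (adelicMpCont.omega (↥(maximalRealSubfield L)) (Fin n)
          (GelbartRogawski1991.UnitaryDualPair.adelicGram (↥(maximalRealSubfield L)) e
            (GelbartRogawski1991.UnitaryDualPair.realDiagonal L dV hdV)
            (GelbartRogawski1991.UnitaryDualPair.realDiagonal L dW hdW))
          (GelbartRogawski1991.UnitaryDualPair.cmPairSplitting L e dV hdV hdV0 dW hdW hdW0 hGR p) Φ) :=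
  continuous_toL2_omega_cmPairSplitting L e dV hdV hdV0 dW hdW hdW0 ν i hi εV εW hDV0 hDW0 hcV hcW htV htW hcc hGR
    (fun v => (Classical.choice (hI v)).input) Φ

include hi in
/-- the same with CANONICAL frames: the consumer supplies a nowhere-zero `c_V` and, per real place, one kind-erased `KAK`
input for the resulting real pair (see `hasThetaMajorants_cmPairSplitting_canonical`). [cite: Weil1964, Chap. III n° 41
Lemme 5 p. 192; GelbartRogawski1991, §3.1 Prop. 3.1.1 p. 455 L1–2; KonnoKonno2007, §3.1 (3.1); Folland1989, §4.2 (4.24)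
p. 156] -/
theorem continuous_toL2_omega_cmPairSplitting_canonical
    (cV : {v : InfinitePlace ↥(maximalRealSubfield L) // v.IsReal} → ℝ) (hcV : ∀ v, cV v ≠ 0)
    (hGR : (GelbartRogawski1991.UnitaryDualPair.cmSplittingDatum L e dV hdV hdV0 dW hdW hdW0).CompatibleSplitting)
    (hI : ∀ v, Nonempty (AnyLeviKAKInput
      ((fun g : Ginf (PosIdx (placeSignVec (cmRealVec L dV hdV) cV v)) (NegIdx (placeSignVec (cmRealVec L dV hdV) cV v)) (PosIdx (placeSignVec (cmRealVec L dW hdW) (fun v =>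
          ((cmPlaceOver L v).1.embedding (GelbartRogawski1991.UnitaryDualPair.imagUnit L)).im / cV v) v)) (NegIdx (placeSignVec (cmRealVec L dW hdW) (fun v =>
          ((cmPlaceOver L v).1.embedding (GelbartRogawski1991.UnitaryDualPair.imagUnit L)).im / cV v) v)) => (⇑((ι𝕎 (PosIdx (placeSignVec (cmRealVec L dV hdV) cV v)) (NegIdx (placeSignVec (cmRealVec L dV hdV) cV v)) (PosIdx (placeSignVec (cmRealVec L dW hdW) (fun v =>
          ((cmPlaceOver L v).1.embedding (GelbartRogawski1991.UnitaryDualPair.imagUnit L)).im / cV v) v)) (NegIdx (placeSignVec (cmRealVec L dW hdW) (fun v =>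
          ((cmPlaceOver L v).1.embedding (GelbartRogawski1991.UnitaryDualPair.imagUnit L)).im / cV v) v)) g).1 : ((DPIdx (PosIdx (placeSignVec (cmRealVec L dV hdV) cV v)) (NegIdx (placeSignVec (cmRealVec L dV hdV) cV v)) (PosIdx (placeSignVec (cmRealVec L dW hdW) (fun v =>
          ((cmPlaceOver L v).1.embedding (GelbartRogawski1991.UnitaryDualPair.imagUnit L)).im / cV v) v)) (NegIdx (placeSignVec (cmRealVec L dW hdW) (fun v =>
          ((cmPlaceOver L v).1.embedding (GelbartRogawski1991.UnitaryDualPair.imagUnit L)).im / cV v) v)) → ℝ) × (DPIdx (PosIdx (placeSignVec (cmRealVec L dV hdV) cV v)) (NegIdx (placeSignVec (cmRealVec L dV hdV) cV v)) (PosIdx (placeSignVec (cmRealVec L dW hdW) (fun v =>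
          ((cmPlaceOver L v).1.embedding (GelbartRogawski1991.UnitaryDualPair.imagUnit L)).im / cV v) v)) (NegIdx (placeSignVec (cmRealVec L dW hdW) (fun v =>
          ((cmPlaceOver L v).1.embedding (GelbartRogawski1991.UnitaryDualPair.imagUnit L)).im / cV v) v)) → ℝ)) ≃ₗ[ℝ] ((DPIdx (PosIdx (placeSignVec (cmRealVec L dV hdV) cV v)) (NegIdx (placeSignVec (cmRealVec L dV hdV) cV v)) (PosIdx (placeSignVec (cmRealVec L dW hdW) (fun v =>
          ((cmPlaceOver L v).1.embedding (GelbartRogawski1991.UnitaryDualPair.imagUnit L)).im / cV v) v)) (NegIdx (placeSignVec (cmRealVec L dW hdW) (fun v =>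
          ((cmPlaceOver L v).1.embedding (GelbartRogawski1991.UnitaryDualPair.imagUnit L)).im / cV v) v)) → ℝ) × (DPIdx (PosIdx (placeSignVec (cmRealVec L dV hdV) cV v)) (NegIdx (placeSignVec (cmRealVec L dV hdV) cV v)) (PosIdx (placeSignVec (cmRealVec L dW hdW) (fun v =>
          ((cmPlaceOver L v).1.embedding (GelbartRogawski1991.UnitaryDualPair.imagUnit L)).im / cV v) v)) (NegIdx (placeSignVec (cmRealVec L dW hdW) (fun v =>
          ((cmPlaceOver L v).1.embedding (GelbartRogawski1991.UnitaryDualPair.imagUnit L)).im / cV v) v)) → ℝ))) : PhaseMap (DPIdx (PosIdx (placeSignVec (cmRealVec L dV hdV) cV v)) (NegIdx (placeSignVec (cmRealVec L dV hdV) cV v)) (PosIdx (placeSignVec (cmRealVec L dW hdW) (fun v =>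
          ((cmPlaceOver L v).1.embedding (GelbartRogawski1991.UnitaryDualPair.imagUnit L)).im / cV v) v)) (NegIdx (placeSignVec (cmRealVec L dW hdW) (fun v =>
          ((cmPlaceOver L v).1.embedding (GelbartRogawski1991.UnitaryDualPair.imagUnit L)).im / cV v) v))))))))
    (Φ : piSchwartzBruhat (↥(maximalRealSubfield L)) (Fin n)) :
    Continuous fun
      (p : ↥(UnitaryGroup.adelic (↥(maximalRealSubfield L)) L (IsCMField.complexConj L) N (Matrix.diagonal dV)) ×
        ↥(UnitaryGroup.adelic (↥(maximalRealSubfield L)) L (IsCMField.complexConj L) M (Matrix.diagonal dW))) =>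
      i (adelicMpCont.omega (↥(maximalRealSubfield L)) (Fin n)
          (GelbartRogawski1991.UnitaryDualPair.adelicGram (↥(maximalRealSubfield L)) e
            (GelbartRogawski1991.UnitaryDualPair.realDiagonal L dV hdV)
            (GelbartRogawski1991.UnitaryDualPair.realDiagonal L dW hdW))
          (GelbartRogawski1991.UnitaryDualPair.cmPairSplitting L e dV hdV hdV0 dW hdW hdW0 hGR p) Φ) :=
  continuous_toL2_omega_pairSplitting_canonical L (IsCMField.complexConj L) N M e (cmRealVec L dV hdV)
    (cmRealVec L dW hdW) (GelbartRogawski1991.UnitaryDualPair.realDiagonal_map L dV hdV).symm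
    (GelbartRogawski1991.UnitaryDualPair.realDiagonal_map L dW hdW).symm
    (GelbartRogawski1991.UnitaryDualPair.complexConj_imagUnit L)
    (GelbartRogawski1991.UnitaryDualPair.imagUnit_ne_zero L)
    (GelbartRogawski1991.UnitaryDualPair.imagUnit_mul_self L)
    (GelbartRogawski1991.UnitaryDualPair.realDiagonal_isSymm L dV hdV)
    (GelbartRogawski1991.UnitaryDualPair.realDiagonal_isSymm L dW hdW) ν i hi
    (IsCMField.complexConj_ne_one L) (cmPlaceOver L) (cmPlaceOver_smul L) (cmPlaceOver_comap L) cV hcV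
    (GelbartRogawski1991.UnitaryDualPair.isUnit_det_realDiagonal L dV hdV hdV0)
    (GelbartRogawski1991.UnitaryDualPair.isUnit_det_realDiagonal L dW hdW hdW0) hI
    (GelbartRogawski1991.UnitaryDualPair.splittingOf_isCompatible _ _ _ _ _ _ _ _ _ _ _ _ _ _ _ _ _ hGR)
    (GelbartRogawski1991.UnitaryDualPair.continuous_splittingOf _ _ _ _ _ _ _ _ _ _ _ _ _ _ _ _ _ hGR) Φ

include hi in
/-- **THE CONSUMER'S FORM — sign facts through complex embeddings.**  Through a distinguished `ι₁ : L →+* ℂ`, all but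
one of the `re ι₁(d_V i)` of a common strict sign and the `re ι₁(d_W j)` of a common strict sign; through every `τ` at
another place, the `re τ(d_V i)` of a common strict sign and all but at most one `re τ(d_W j)` positive or all negative.
Then every orbit map `(u₁, u₂) ↦ [ω_ψ(s_pair(u₁, u₂)) Φ]` of the CM pair splitting is continuous in `L²(𝐀ⁿ, ν)`.
[cite: Weil1964, Chap. III n° 41 Lemme 5 p. 192, n° 39 p. 189; GelbartRogawski1991, §3.1 Prop. 3.1.1 p. 455 L1–2;
KonnoKonno2007, §3.1 (3.1); Folland1989, §4.2 (4.24) p. 156, Prop. (4.39); Knapp2002, Thm 7.39] -/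
theorem continuous_toL2_omega_cmPairSplitting_of_signs (ι₁ : L →+* ℂ)
    (hGR : (GelbartRogawski1991.UnitaryDualPair.cmSplittingDatum L e dV hdV hdV0 dW hdW hdW0).CompatibleSplitting)
    (h₁V : ∃ i₀ : Fin N, (∀ i, i ≠ i₀ → 0 < (ι₁ (dV i)).re) ∨ ∀ i, i ≠ i₀ → (ι₁ (dV i)).re < 0)
    (h₁W : (∀ j, 0 < (ι₁ (dW j)).re) ∨ ∀ j, (ι₁ (dW j)).re < 0)
    (hV : ∀ τ : L →+* ℂ, InfinitePlace.mk τ ≠ InfinitePlace.mk ι₁ →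
      (∀ i, 0 < (τ (dV i)).re) ∨ ∀ i, (τ (dV i)).re < 0)
    (hW : ∀ τ : L →+* ℂ, InfinitePlace.mk τ ≠ InfinitePlace.mk ι₁ →
      (∃ j₀ : Fin M, ∀ j, j ≠ j₀ → 0 < (τ (dW j)).re) ∨ ∀ j, (τ (dW j)).re < 0)
    (Φ : piSchwartzBruhat (↥(maximalRealSubfield L)) (Fin n)) :
    Continuous fun
      (p : ↥(UnitaryGroup.adelic (↥(maximalRealSubfield L)) L (IsCMField.complexConj L) N (Matrix.diagonal dV)) ×
        ↥(UnitaryGroup.adelic (↥(maximalRealSubfield L)) L (IsCMField.complexConj L) M (Matrix.diagonal dW))) =>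
      i (adelicMpCont.omega (↥(maximalRealSubfield L)) (Fin n)
          (GelbartRogawski1991.UnitaryDualPair.adelicGram (↥(maximalRealSubfield L)) e
            (GelbartRogawski1991.UnitaryDualPair.realDiagonal L dV hdV)
            (GelbartRogawski1991.UnitaryDualPair.realDiagonal L dW hdW))
          (GelbartRogawski1991.UnitaryDualPair.cmPairSplitting L e dV hdV hdV0 dW hdW hdW0 hGR p) Φ) :=
  continuous_toL2_omega_cmPairSplitting_canonical L e dV hdV hdV0 dW hdW hdW0 ν i hi (cmSignConv L dV ι₁)
    (cmSignConv_ne_zero L dV ι₁) hGR (nonempty_anyLeviKAKInput_cmSignConv L dV hdV dW hdW ι₁ h₁V h₁W hV hW) Φ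

end CM

/-! ## §3 A hermitian plane and a hermitian LINE as second factor -/

section CMSmall

variable (L : Type) [Field L] [NumberField L] [IsCMField L]
variable [MeasurableSpace (AdeleRing (𝓞 ↥(maximalRealSubfield L)) ↥(maximalRealSubfield L))]
  [BorelSpace (AdeleRing (𝓞 ↥(maximalRealSubfield L)) ↥(maximalRealSubfield L))]

/-- **hermitian PLANE `W`** (`M = 2`): away from `ι₁` no hypothesis on `W` (`signs_fin_two`). [cite: Weil1964, Chap. III
n° 41 Lemme 5 p. 192; GelbartRogawski1991, §3.1 Prop. 3.1.1 p. 455 L1–2; Folland1989, §4.2 (4.24) p. 156] -/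
theorem continuous_toL2_omega_cmPairSplitting_of_signs_two {N n : ℕ} (e : Fin N × Fin 2 ≃ Fin n)
    (dV : Fin N → L) (hdV : ∀ i, IsCMField.complexConj L (dV i) = dV i) (hdV0 : ∀ i, dV i ≠ 0)
    (dW : Fin 2 → L) (hdW : ∀ i, IsCMField.complexConj L (dW i) = dW i) (hdW0 : ∀ i, dW i ≠ 0)
    (ν : Measure (Fin n → AdeleRing (𝓞 ↥(maximalRealSubfield L)) ↥(maximalRealSubfield L))) [ν.IsAddHaarMeasure]
    (i : piSchwartzBruhat (↥(maximalRealSubfield L)) (Fin n) →ₗ[ℂ] Lp ℂ 2 ν)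
    (hi : ∀ Φ : piSchwartzBruhat (↥(maximalRealSubfield L)) (Fin n),
      ((i Φ : Lp ℂ 2 ν) : (Fin n → AdeleRing (𝓞 ↥(maximalRealSubfield L)) ↥(maximalRealSubfield L)) → ℂ) =ᵐ[ν]
        (Φ : (Fin n → AdeleRing (𝓞 ↥(maximalRealSubfield L)) ↥(maximalRealSubfield L)) → ℂ))
    (ι₁ : L →+* ℂ)
    (hGR : (GelbartRogawski1991.UnitaryDualPair.cmSplittingDatum L e dV hdV hdV0 dW hdW hdW0).CompatibleSplitting)
    (h₁V : ∃ i₀ : Fin N, (∀ i, i ≠ i₀ → 0 < (ι₁ (dV i)).re) ∨ ∀ i, i ≠ i₀ → (ι₁ (dV i)).re < 0)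
    (h₁W : (∀ j, 0 < (ι₁ (dW j)).re) ∨ ∀ j, (ι₁ (dW j)).re < 0)
    (hV : ∀ τ : L →+* ℂ, InfinitePlace.mk τ ≠ InfinitePlace.mk ι₁ →
      (∀ i, 0 < (τ (dV i)).re) ∨ ∀ i, (τ (dV i)).re < 0)
    (Φ : piSchwartzBruhat (↥(maximalRealSubfield L)) (Fin n)) :
    Continuous fun
      (p : ↥(UnitaryGroup.adelic (↥(maximalRealSubfield L)) L (IsCMField.complexConj L) N (Matrix.diagonal dV)) ×
        ↥(UnitaryGroup.adelic (↥(maximalRealSubfield L)) L (IsCMField.complexConj L) 2 (Matrix.diagonal dW))) =>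
      i (adelicMpCont.omega (↥(maximalRealSubfield L)) (Fin n)
          (GelbartRogawski1991.UnitaryDualPair.adelicGram (↥(maximalRealSubfield L)) e
            (GelbartRogawski1991.UnitaryDualPair.realDiagonal L dV hdV)
            (GelbartRogawski1991.UnitaryDualPair.realDiagonal L dW hdW))
          (GelbartRogawski1991.UnitaryDualPair.cmPairSplitting L e dV hdV hdV0 dW hdW hdW0 hGR p) Φ) :=
  continuous_toL2_omega_cmPairSplitting_of_signs L e dV hdV hdV0 dW hdW hdW0 ν i hi ι₁ hGR h₁V h₁W hV (fun τ _ =>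
    signs_fin_two fun j => re_apply_ne_zero_of_complexConj_eq L τ (hdW j) (hdW0 j)) Φ

omit [NumberField L] [IsCMField L] in
/-- one non-zero real: it is positive or negative (the `M = 1` sign fact). [folklore] -/
private theorem signs_fin_one {y : Fin 1 → ℝ} (hy : ∀ j, y j ≠ 0) : (∀ j, 0 < y j) ∨ ∀ j, y j < 0 := by
  rcases lt_or_gt_of_ne (hy 0) with h | h
  · exact Or.inr fun j => by rw [Subsingleton.elim j 0]; exact h
  · exact Or.inl fun j => by rw [Subsingleton.elim j 0]; exact h

/-- **hermitian LINE `W = ⟨d_W⟩`** (`M = 1`) — the dual pair `U(V) × U(1)` of [GelbartRogawski1991, Prop. 3.1.1] itself: NO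
hypothesis on `W` at any place (one non-zero real number has a sign); the input is `V` of real rank `≤ 1` through `ι₁` and
definite through every other embedding.  Every orbit map `(u₁, u₂) ↦ [ω_ψ(s_pair(u₁, u₂)) Φ]` of the CM pair splitting is
continuous in `L²(𝐀ⁿ, ν)`. [cite: Weil1964, Chap. III n° 41 Lemme 5 p. 192, n° 39 p. 189; GelbartRogawski1991, §3.1
Prop. 3.1.1 p. 455 L1–2; KonnoKonno2007, §3.1 (3.1); Folland1989, §4.2 (4.24) p. 156, Prop. (4.39)] -/
theorem continuous_toL2_omega_cmPairSplitting_of_signs_one {N n : ℕ} (e : Fin N × Fin 1 ≃ Fin n)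
    (dV : Fin N → L) (hdV : ∀ i, IsCMField.complexConj L (dV i) = dV i) (hdV0 : ∀ i, dV i ≠ 0)
    (dW : Fin 1 → L) (hdW : ∀ i, IsCMField.complexConj L (dW i) = dW i) (hdW0 : ∀ i, dW i ≠ 0)
    (ν : Measure (Fin n → AdeleRing (𝓞 ↥(maximalRealSubfield L)) ↥(maximalRealSubfield L))) [ν.IsAddHaarMeasure]
    (i : piSchwartzBruhat (↥(maximalRealSubfield L)) (Fin n) →ₗ[ℂ] Lp ℂ 2 ν)
    (hi : ∀ Φ : piSchwartzBruhat (↥(maximalRealSubfield L)) (Fin n),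
      ((i Φ : Lp ℂ 2 ν) : (Fin n → AdeleRing (𝓞 ↥(maximalRealSubfield L)) ↥(maximalRealSubfield L)) → ℂ) =ᵐ[ν]
        (Φ : (Fin n → AdeleRing (𝓞 ↥(maximalRealSubfield L)) ↥(maximalRealSubfield L)) → ℂ))
    (ι₁ : L →+* ℂ)
    (hGR : (GelbartRogawski1991.UnitaryDualPair.cmSplittingDatum L e dV hdV hdV0 dW hdW hdW0).CompatibleSplitting)
    (h₁V : ∃ i₀ : Fin N, (∀ i, i ≠ i₀ → 0 < (ι₁ (dV i)).re) ∨ ∀ i, i ≠ i₀ → (ι₁ (dV i)).re < 0)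
    (hV : ∀ τ : L →+* ℂ, InfinitePlace.mk τ ≠ InfinitePlace.mk ι₁ →
      (∀ i, 0 < (τ (dV i)).re) ∨ ∀ i, (τ (dV i)).re < 0)
    (Φ : piSchwartzBruhat (↥(maximalRealSubfield L)) (Fin n)) :
    Continuous fun
      (p : ↥(UnitaryGroup.adelic (↥(maximalRealSubfield L)) L (IsCMField.complexConj L) N (Matrix.diagonal dV)) ×
        ↥(UnitaryGroup.adelic (↥(maximalRealSubfield L)) L (IsCMField.complexConj L) 1 (Matrix.diagonal dW))) =>
      i (adelicMpCont.omega (↥(maximalRealSubfield L)) (Fin n)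
          (GelbartRogawski1991.UnitaryDualPair.adelicGram (↥(maximalRealSubfield L)) e
            (GelbartRogawski1991.UnitaryDualPair.realDiagonal L dV hdV)
            (GelbartRogawski1991.UnitaryDualPair.realDiagonal L dW hdW))
          (GelbartRogawski1991.UnitaryDualPair.cmPairSplitting L e dV hdV hdV0 dW hdW hdW0 hGR p) Φ) :=
  continuous_toL2_omega_cmPairSplitting_of_signs L e dV hdV hdV0 dW hdW hdW0 ν i hi ι₁ hGR h₁V
    (signs_fin_one fun j => re_apply_ne_zero_of_complexConj_eq L ι₁ (hdW j) (hdW0 j))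
    hV (fun τ _ => Or.imp_left (fun h => ⟨0, fun j _ => h j⟩)
      (signs_fin_one fun j => re_apply_ne_zero_of_complexConj_eq L τ (hdW j) (hdW0 j))) Φ

end CMSmall

end Literature.NumberTheory.Weil1964

end
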